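import Literature.Computability.AlgebraicComplexity.ConstantFreeDegree
import Literature.Computability.AlgebraicComplexity.ValiantConjectureProofs
import HarnessLib

/-!
# The permanent family is in `VNP⁰` (constant-free Valiant class)

`PER = (PER_n)_n ∈ VNP⁰` (Malod 2003 / Koiran 2004 / Bürgisser 2009, Def. 2.8: the constant-free
analogue of Valiant's `PER ∈ VNP`; used as the remark "Note that this set has a `VNP⁰`-natural
proof, namely the permanent itself" in Bläser–Ikenmeyer–Jindal–Lysikov 2018, §6, ECCC TR18-064
p. 17, the step that makes their Thm. 5 a special case of their Thm. 6).

The tree already has Valiant's witness for `PER ∈ VNP` in the form of Ryser's formula,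
`perVNPWitness n k = (∏_j (Y_j + Y_j − 1)) · ∏_i ∑_j Y_j X_{ji}` with
`boolSum (perVNPWitness n k) = perPoly (Fin n) k` (`ValiantConjectureProofs.lean`,
BCS 1997 Prop. (21.15) / Rem. (21.16)(2)). That witness uses only the constants `±1`, so the
`(size, formal degree)` calculus `HasTauDeg` of `ConstantFreeDegree.lean` shows it is a `VP⁰`
family (size `≤ 2n² + 4n + 1`, formal degree `≤ 3n + 2`), whence `PER ∈ VNP⁰`
(`isVNP0Family_perPoly`). Theorem-only file. HONEST FRAMING: nothing here bears on whether
`PER ∈ VP⁰`; `VP ≠ VNP` is NOT proved.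

## References
* [BlaserIkenmeyerJindalLysikov2018] §6, ECCC TR18-064 p. 17 ("this set has a `VNP⁰`-natural
  proof, namely the permanent itself"); App. A, Def. 29 (`VP⁰`, `VNP⁰`).
* [Burgisser2006] Def. 2.7–2.8 (`VP⁰`, `VNP⁰`).
* [BurgisserClausenShokrollahi1997] Prop. (21.15), Rem. (21.16)(2) (the witness).
-/

noncomputable section

open MvPolynomial

universe u v w

namespace Literature.Computability.AlgebraicComplexity

/-! ### Size and formal degree of the Ryser witness -/

/-- The sign selector `∏_j (Y_j + Y_j − 1)` has a constant-free circuit of size `≤ 3n` and formal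
degree `≤ n + 1`. [cite: BurgisserClausenShokrollahi1997, Prop. (21.15)] -/
theorem hasTauDeg_perVNPSign (n : ℕ) : HasTauDeg (perVNPSign n ℤ) (3 * n) (n + 1) := by
  unfold perVNPSign
  have h : ∀ j ∈ (Finset.univ : Finset (Fin n)),
      HasTauDeg ((X (Sum.inr j) + X (Sum.inr j) + C (-1) :
        MvPolynomial ((Fin n × Fin n) ⊕ Fin n) ℤ)) 2 1 := by
    intro j _
    have h1 := ((HasTauDeg.X (σ := (Fin n × Fin n) ⊕ Fin n) (Sum.inr j)).add
      (HasTauDeg.X (Sum.inr j))).add (HasTauDeg.C ArithCircuit.isSignConstant_neg_one)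
    exact h1.mono (by omega) (by omega)
  refine (HasTauDeg.finset_prod _ h).mono ?_ ?_
  · simp; omega
  · simp

/-- The cover polynomial `∏_i ∑_j Y_j X_{ji}` has a constant-free circuit of size `≤ 2n² + n`
and formal degree `≤ 2n + 1`. [cite: BurgisserClausenShokrollahi1997, Prop. (21.15)] -/
theorem hasTauDeg_perVNPCover (n : ℕ) :
    HasTauDeg (perVNPCover n ℤ) (2 * n * n + n) (2 * n + 1) := by
  unfold perVNPCover
  have hterm : ∀ (i j : Fin n), HasTauDeg ((X (Sum.inr j) * X (Sum.inl (j, i)) :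
      MvPolynomial ((Fin n × Fin n) ⊕ Fin n) ℤ)) 1 2 := by
    intro i j
    have h1 := (HasTauDeg.X (σ := (Fin n × Fin n) ⊕ Fin n) (Sum.inr j)).mul
      (HasTauDeg.X (Sum.inl (j, i)))
    exact h1.mono (by omega) (by omega)
  have hrow : ∀ i ∈ (Finset.univ : Finset (Fin n)),
      HasTauDeg (∑ j : Fin n, (X (Sum.inr j) * X (Sum.inl (j, i)) :
        MvPolynomial ((Fin n × Fin n) ⊕ Fin n) ℤ)) (2 * n) 2 := by
    intro i _
    refine (HasTauDeg.finset_sum _ fun j _ => hterm i j).mono ?_ ?_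
    · simp; omega
    · simp
  refine (HasTauDeg.finset_prod _ hrow).mono ?_ ?_
  · simp; ring_nf; omega
  · simp; omega

/-- **The Ryser witness is constant-free cheap**: size `≤ 2n² + 4n + 1`, formal degree `≤ 3n + 2`.
[cite: BurgisserClausenShokrollahi1997, Prop. (21.15)] -/
theorem hasTauDeg_perVNPWitness (n : ℕ) :
    HasTauDeg (perVNPWitness n ℤ) (2 * n * n + 4 * n + 1) (3 * n + 2) := by
  unfold perVNPWitness
  exact ((hasTauDeg_perVNPSign n).mul (hasTauDeg_perVNPCover n)).mono (by omega) (by omega)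

/-! ### `VP⁰` and `VNP⁰` membership -/

/-- **The Ryser witness family is in `VP⁰`** (Bürgisser 2009, Def. 2.7: `n² + n` variables,
constant-free circuits of size `≤ 2n² + 4n + 1` and formal degree `≤ 3n + 2`).
[cite: Burgisser2006, Def. 2.7] -/
theorem isVP0Family_perVNPWitness :
    IsVP0Family (σ := fun n => (Fin n × Fin n) ⊕ Fin n) fun n => perVNPWitness n ℤ := by
  have h := fun n => hasTauDeg_perVNPWitness n
  choose P h1 h2 h3 h4 h5 using h
  refine ⟨?_, P, fun n => ⟨h1 n, h2 n, h3 n⟩, ?_, ?_⟩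
  · refine (IsPBounded.iff_exists_le_mul_succ_pow _).2 ⟨1, 2, fun n => ?_⟩
    have e : 1 * (n + 1) ^ 2 = n * n + 2 * n + 1 := by ring
    simp only [Fintype.card_sum, Fintype.card_prod, Fintype.card_fin]
    omega
  · refine (IsPBounded.iff_exists_le_mul_succ_pow _).2 ⟨4, 2, fun n => (h4 n).trans ?_⟩
    have e : 4 * (n + 1) ^ 2 = 4 * n * n + 8 * n + 4 := by ring
    rw [e]; nlinarith
  · refine (IsPBounded.iff_exists_le_mul_succ_pow _).2 ⟨3, 1, fun n => (h5 n).trans ?_⟩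
    rw [pow_one]; omega

/-- **`PER ∈ VNP⁰`**: the permanent family `(PER_n)_n` (integer coefficients, variables
`Fin n × Fin n`) is in the constant-free class `VNP⁰`, with the Ryser witness and a Boolean sum of
length `n` ("Note that this set has a `VNP⁰`-natural proof, namely the permanent itself").
[cite: BlaserIkenmeyerJindalLysikov2018, §6 (p. 17) and Def. 29]
[cite: BurgisserClausenShokrollahi1997, Prop. (21.15)] -/
theorem isVNP0Family_perPoly :
    IsVNP0Family (σ := fun n => Fin n × Fin n) fun n => perPoly (Fin n) ℤ :=
  ⟨fun n => n, fun n => perVNPWitness n ℤ, isVP0Family_perVNPWitness,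
    fun n => (boolSum_perVNPWitness n ℤ).symm⟩

/-- `VNP⁰` is stable under renamings into p-bounded variable types (rename the witness on the
free variables; the Boolean sum commutes with such renamings, `boolSum_rename_sumMap`).
[cite: Burgisser2006, Def. 2.8] -/
theorem IsVNP0Family.rename {σ : ℕ → Type v} {τ : ℕ → Type w} [∀ n, Fintype (σ n)]
    [∀ n, Fintype (τ n)] {f : ∀ n, MvPolynomial (σ n) ℤ} (hf : IsVNP0Family f)
    (e : ∀ n, σ n → τ n) (hτ : IsPBounded fun n => Fintype.card (τ n)) :
    IsVNP0Family fun n => MvPolynomial.rename (e n) (f n) := by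
  obtain ⟨u, g, hg, hfg⟩ := hf
  have hu : IsPBounded u := hg.1.mono fun n => by simp [Fintype.card_sum]
  refine ⟨u, fun n => MvPolynomial.rename (Sum.map (e n) id) (g n),
    hg.rename (fun n => Sum.map (e n) id) ?_, fun n => ?_⟩
  · have h := IsPBounded.add_holds hτ hu
    exact h.mono fun n => by simp [Fintype.card_sum]
  · rw [boolSum_rename_sumMap, ← hfg n]

end Literature.Computability.AlgebraicComplexity

end
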